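import Summits.ABC.IUTFork.Repair.RHRound4Objects
import Summits.ABC.IUTFork.Repair.RHReqsideWeightLawsHeightScaling
import Summits.ABC.IUTFork.Repair.RHR4DiscriminatorOneSided
import HarnessLib

/-!
# R-H ROUND 4, R4-3 — census row O-35 (`isogenous-theta-first-power`): the object's D2 CLASS STATEMENT
# `isoThetaFirstPower_classStatement` PROVED — exponent `−1` along the height ray (KILLED shape; «not a rescue alone»)

PROOF-ONLY file (0 definitions, 0 `Prop` facts; abc-iut cell, rung LADDER-ABC:A2.RESCUE.H; seat abc-iut-rh4-typ-1, KEY `wake/KEY-abc-iut-rh4-typ-1-R4IDEA-TYPE.md`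
2342d1cdeb6caa1f, idle-time rider announced on STATUS). The typer's file `RHRound4Objects.lean` (p543184) types the card's object `isoTheta` with footprint
`isoThetaFirstPower := Output.doorTarget 2` and leaves its class statement `isoThetaFirstPower_classStatement ⟨datum⟩ := NegExponent (isoThetaFirstPower.profileL1 ⟨datum⟩)`
as the NAMED statement a prover can be keyed on, «KILLED shape EXPECTED: weights-only, EXP-6 p533167 / BARRIER p531802 verbatim» (card 43cf8ba6c06ec9a5 §0 (d),
verdict rh4-crit-1 cb6fdd389d094aeb F5 CONCUR). THIS FILE proves it, for every datum whose places have `e_w > 0` and `u_w ≥ 0`, with `Σ_w m_w·u_w > 0` and `l⋆ ≥ 2`: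
* `dS_mul_sub_exactDeficit_le` — per place and for EVERY order `M` (so every dilation `t·m_w`): `dS_f(L)·M − DD_f(M) ≤ Π⁰ + L·e` in label units (`den = 1`), where
  `Π⁰ = Σ_{j ≤ L} (jδ + (j+1)G)` is LAW-FREE and ORDER-FREE — abc-iut-rh2-w-1's EXP-6 `ReqsideWeightLaws.HeightScaling.keptSlack_le_budget` BY NAME, rewritten through
  `min(d, d + margin) = d − (−margin)⁺`;
* `isoThetaFirstPower_keptL1At_le` — the exact-tier kept mass `K_L1(t)` of the footprint is below the height-free constant `Σ_w u_w·(Π⁰_w + L·e_w)` at every `t`;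
* `isoThetaFirstPower_massAt` — the required mass is `t·dS·U`, `U = Σ_w m_w u_w` (linear in the dilation);
* `isoThetaFirstPower_classStatement_holds` — hence `ExponentAtMost (profileL1 …) (−1) C` with `C = 2·K⁺/(dS·U)` (`⌊s⌋₊ ≥ s/2` on `s ≥ 1`), i.e. **`NegExponent`**: the
  isogenous theta changes WEIGHTS, not CLASS — the kernel form of the card's own «NOT a rescue by itself» and of verdict F5.
HONEST FRAMING: arithmetic about OUR typed footprint along OUR height dilation; nothing here asserts that abc is proved or refuted, or that [IUTchIII] Cor. 3.12 / [IUTchIV]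
Thm. 1.10 holds or fails at any datum, or takes a side on any author (D-0045); typed ≠ proved for every IUT locution; computed ≠ proved. [claim: Mochizuki2012, status: disputed]
[cite: Mochizuki2012, IUTchIII Cor. 3.12 p. 173–174; IUTchIV Thm. 1.10 Step (v) p. 27–29]
-/

noncomputable section

open Finset

namespace Summit.ABC.IUTFork.Repair.RH.Round4Objects

open Summit.ABC.IUTFork.Repair.RH.ReqsideWeightLaws Summit.ABC.IUTFork.Repair.RH.HeightScaling

/-! ## 1. Per place: the exact-tier kept demand is below the law-free budget at every order -/

/-- `min(d, d + x) = d − (−x)⁺`. [folklore] -/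
private theorem min_add_eq_sub_max (d x : ℤ) : min d (d + x) = d - max 0 (-x) := by
  rcases le_or_gt 0 x with h | h
  · rw [min_eq_left (by linarith), max_eq_left (by linarith)]; ring
  · rw [min_eq_right (by linarith), max_eq_right (by linarith)]; ring

/-- **PER PLACE, EVERY ORDER `M`** (`den = 1`, `e > 0`): `dS_f(L)·M − DD_f(e, M, δ, r_in, r_out; L) ≤ Σ_{j ≤ L}(jδ + (j+1)(r_in − r_out)) + L·e` — EXP-6
`keptSlack_le_budget` (p533167) BY NAME, with `min(demand_j, demand_j + margin_j) = demand_j − (−margin_j)⁺` summed over the labels. [folklore] -/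
theorem dS_mul_sub_exactDeficit_le (f : ℕ → ℤ) {e : ℤ} (he : 0 < e) (M δ rin rout : ℤ) (L : ℕ) :
    demandSum f 1 L * M - ReqsideWeightLaws.exactDeficit f 1 e M δ rin rout L ≤
      ∑ i ∈ range L, ((((i + 1 : ℕ) : ℤ)) * δ + (((i + 1 : ℕ) : ℤ) + 1) * (rin - rout)) + (L : ℤ) * e := by
  have h := ReqsideWeightLaws.HeightScaling.keptSlack_le_budget (den := 1) one_pos he f M δ rin rout L
  have key : ∑ i ∈ range L, min ((f (i + 1) - 1) * M) ((f (i + 1) - 1) * M + 1 * (M - (((i + 1 : ℕ) : ℤ) + 1) * rout -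
        e * ((f (i + 1) * M - 1 * ((((i + 1 : ℕ) : ℤ)) * δ + (((i + 1 : ℕ) : ℤ) + 1) * rin)) / (1 * e)))) =
      demandSum f 1 L * M - ReqsideWeightLaws.exactDeficit f 1 e M δ rin rout L := by
    unfold demandSum ReqsideWeightLaws.exactDeficit ReqsideWeightLaws.margin
    rw [Finset.sum_mul, ← Finset.sum_sub_distrib]
    refine Finset.sum_congr rfl fun i _ => ?_
    rw [one_mul, min_add_eq_sub_max]
  rw [key] at h
  simpa only [mul_one, one_mul] using h

/-! ## 2. The footprint's masses along the height ray -/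

section Datum

variable {ι : Type*}

/-- The required mass of the footprint at dilation `t` is `t·dS_{lawPow 2}(L)·Σ_w m_w u_w` — LINEAR in the dilation. [folklore] -/
theorem isoThetaFirstPower_massAt (s : Finset ι) (m : ι → ℤ) (u : ι → ℝ) (L t : ℕ) :
    isoThetaFirstPower.massAt s m u L t = (t : ℝ) * ((demandSum (lawPow 2) 1 L : ℝ) * ∑ w ∈ s, (m w : ℝ) * u w) := by
  unfold Output.massAt isoThetaFirstPower Output.doorTarget Output.ofLaw reqMass
  simp only [Int.cast_one, div_one]
  rw [Finset.mul_sum, Finset.mul_sum, Finset.mul_sum]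
  exact Finset.sum_congr rfl fun w _ => by ring

/-- **THE EXACT-TIER KEPT MASS IS HEIGHT-FREE BOUNDED**: for places with `e_w > 0`, `u_w ≥ 0`, at every dilation `t`,
`K_L1(t) ≤ Σ_w u_w·(Π⁰_w + L·e_w)` (`Π⁰_w = Σ_{j ≤ L}(jδ_w + (j+1)G_w)`). [folklore] -/
theorem isoThetaFirstPower_keptL1At_le (s : Finset ι) (e m δ rin rout : ι → ℤ) (u : ι → ℝ) (L : ℕ)
    (he : ∀ w ∈ s, 0 < e w) (hu : ∀ w ∈ s, 0 ≤ u w) (t : ℕ) :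
    isoThetaFirstPower.keptL1At s e m δ rin rout u L t ≤
      ∑ w ∈ s, ((∑ i ∈ range L, ((((i + 1 : ℕ) : ℤ)) * δ w + (((i + 1 : ℕ) : ℤ) + 1) * (rin w - rout w)) + (L : ℤ) * e w : ℤ) : ℝ) * u w := by
  unfold Output.keptL1At
  rw [isoThetaFirstPower_massAt, Finset.mul_sum, Finset.mul_sum, ← Finset.sum_sub_distrib]
  refine Finset.sum_le_sum fun w hw => ?_
  have hint := dS_mul_sub_exactDeficit_le (lawPow 2) (he w hw) ((t : ℤ) * m w) (δ w) (rin w) (rout w) L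
  have hreal : ((demandSum (lawPow 2) 1 L : ℤ) : ℝ) * ((t : ℝ) * (m w : ℝ)) -
      ((ReqsideWeightLaws.exactDeficit (lawPow 2) 1 (e w) ((t : ℤ) * m w) (δ w) (rin w) (rout w) L : ℤ) : ℝ) ≤
      ((∑ i ∈ range L, ((((i + 1 : ℕ) : ℤ)) * δ w + (((i + 1 : ℕ) : ℤ) + 1) * (rin w - rout w)) + (L : ℤ) * e w : ℤ) : ℝ) := by
    exact_mod_cast hint
  have hDD : isoThetaFirstPower.exactDeficit (e w) ((t : ℤ) * m w) (δ w) (rin w) (rout w) L =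
      ReqsideWeightLaws.exactDeficit (lawPow 2) 1 (e w) ((t : ℤ) * m w) (δ w) (rin w) (rout w) L := rfl
  rw [hDD]
  have h2 := mul_le_mul_of_nonneg_right hreal (hu w hw)
  have h3 : (t : ℝ) * (((demandSum (lawPow 2) 1 L : ℤ) : ℝ) * ((m w : ℝ) * u w)) -
      ((ReqsideWeightLaws.exactDeficit (lawPow 2) 1 (e w) ((t : ℤ) * m w) (δ w) (rin w) (rout w) L : ℤ) : ℝ) * u w =
      (((demandSum (lawPow 2) 1 L : ℤ) : ℝ) * ((t : ℝ) * (m w : ℝ)) -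
        ((ReqsideWeightLaws.exactDeficit (lawPow 2) 1 (e w) ((t : ℤ) * m w) (δ w) (rin w) (rout w) L : ℤ) : ℝ)) * u w := by ring
  rw [h3]
  exact h2

/-! ## 3. The class statement: exponent `−1`, hence `NegExponent` -/

/-- `⌊s⌋₊ ≥ s/2` for `s ≥ 1`. [folklore] -/
private theorem half_le_natFloor {σ : ℝ} (hσ : 1 ≤ σ) : σ / 2 ≤ (⌊σ⌋₊ : ℝ) := by
  have h1 : (1 : ℝ) ≤ (⌊σ⌋₊ : ℝ) := by exact_mod_cast Nat.one_le_iff_ne_zero.mpr (Nat.pos_iff_ne_zero.mp (Nat.floor_pos.mpr hσ))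
  have h2 : σ < (⌊σ⌋₊ : ℝ) + 1 := Nat.lt_floor_add_one σ
  linarith

/-- **`isoThetaFirstPower_classStatement` HOLDS** at every datum with `e_w > 0`, `u_w ≥ 0` on its places, positive weighted depth `Σ_w m_w u_w > 0` and `l⋆ ≥ 2`:
the exact-tier recovered fraction of the isogenous theta's footprint has `ExponentAtMost … (−1) C` along the height ray, `C = 2·K⁺/(dS·U)` explicit — so it is
`NegExponent` (p532994): KILLED shape in the kernel; the object changes WEIGHTS, not CLASS (card §0 (d); verdict F5). [folklore] -/
theorem isoThetaFirstPower_classStatement_holds (s : Finset ι) (e m δ rin rout : ι → ℤ) (u : ι → ℝ) {L : ℕ} (hL : 2 ≤ L)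
    (he : ∀ w ∈ s, 0 < e w) (hu : ∀ w ∈ s, 0 ≤ u w) (hU : 0 < ∑ w ∈ s, (m w : ℝ) * u w) :
    isoThetaFirstPower_classStatement s e m δ rin rout u L := by
  unfold isoThetaFirstPower_classStatement
  set K : ℝ := ∑ w ∈ s, ((∑ i ∈ range L, ((((i + 1 : ℕ) : ℤ)) * δ w + (((i + 1 : ℕ) : ℤ) + 1) * (rin w - rout w)) + (L : ℤ) * e w : ℤ) : ℝ) * u w
    with hK
  set D : ℝ := ((demandSum (lawPow 2) 1 L : ℤ) : ℝ) with hD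
  set U : ℝ := ∑ w ∈ s, (m w : ℝ) * u w with hUdef
  have hDpos : 0 < D := by
    rw [hD]; exact_mod_cast Summit.ABC.IUTFork.Repair.RH.R4Discriminator.demandSum_lawPow_pos (le_refl 2) hL
  have hDU : 0 < D * U := mul_pos hDpos hU
  refine ⟨-1, 2 * max K 0 / (D * U), by norm_num, div_nonneg (mul_nonneg (by norm_num) (le_max_right _ _)) hDU.le, fun σ hσ => ?_⟩
  have ht : σ / 2 ≤ (⌊σ⌋₊ : ℝ) := half_le_natFloor hσ
  have hσ0 : 0 < σ := by linarith
  have htpos : 0 < (⌊σ⌋₊ : ℝ) := by linarith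
  have hmass : isoThetaFirstPower.massAt s m u L ⌊σ⌋₊ = (⌊σ⌋₊ : ℝ) * (D * U) := isoThetaFirstPower_massAt s m u L ⌊σ⌋₊
  have hkept : isoThetaFirstPower.keptL1At s e m δ rin rout u L ⌊σ⌋₊ ≤ K := isoThetaFirstPower_keptL1At_le s e m δ rin rout u L he hu ⌊σ⌋₊
  have hmpos : 0 < (⌊σ⌋₊ : ℝ) * (D * U) := mul_pos htpos hDU
  show isoThetaFirstPower.keptL1At s e m δ rin rout u L ⌊σ⌋₊ / isoThetaFirstPower.massAt s m u L ⌊σ⌋₊ ≤ 2 * max K 0 / (D * U) * σ ^ (-1 : ℝ)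
  rw [hmass, Real.rpow_neg_one]
  calc isoThetaFirstPower.keptL1At s e m δ rin rout u L ⌊σ⌋₊ / ((⌊σ⌋₊ : ℝ) * (D * U))
      ≤ max K 0 / ((⌊σ⌋₊ : ℝ) * (D * U)) := div_le_div_of_nonneg_right (hkept.trans (le_max_left _ _)) hmpos.le
    _ ≤ max K 0 / ((σ / 2) * (D * U)) := by
        apply div_le_div_of_nonneg_left (le_max_right _ _) (mul_pos (by linarith) hDU)
        exact mul_le_mul_of_nonneg_right ht hDU.le
    _ = 2 * max K 0 / (D * U) * σ⁻¹ := by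
        field_simp

end Datum

end Summit.ABC.IUTFork.Repair.RH.Round4Objects

end
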